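import Summits.SmoothPoincare4.SmoothPoincare4.Theses.CylinderEntropy
import Summits.SmoothPoincare4.SmoothPoincare4.Theorems.CylinderEntropySliceIsolationStubConformalEmbedding
import Summits.SmoothPoincare4.SmoothPoincare4.Theorems.CylinderEntropySliceIsolationStubGroundStateContinuity
import Literature.Geometry.Riemannian.LowEntropyHypersurfacesFourProofs
import Literature.Geometry.Riemannian.SphericalCylinderEntropy
import Literature.Geometry.Riemannian.SphericalCylinderSmallScaleDomination
import Literature.Topology.FourManifolds.HomotopyS4CompactProofs
import Literature.Topology.FourManifolds.HomotopyS4SimplyConnected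
import Literature.Topology.FourManifolds.SphereSimplyConnected
import HarnessLib

/-!
# `CylinderEntropy.SliceIsolation` reduced to slab confinement (line `conformal-kernel-domination`, crux stmt-SmoothPoincare4-7632)

The kernel-checked REDUCTION of the crux `Summit.SmoothPoincare4.SmoothPoincare4.Theses.CylinderEntropy.SliceIsolation`
("a universal `ε > 0`: a homotopy 4-sphere smoothly embedded in `N = S⁴ × ℝ ⊂ ℝ⁶` as an end-separating cross-section
with typed cylinder entropy `< 1 + ε` is diffeomorphic to `S⁴`") to THREE named inputs, everything else being proved in
the tree:

1. `Literature.Geometry.Riemannian.ChodoshMantoulidisSchulze2025_lowEntropy_sphere_four` — named published fact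
   (Chodosh–Mantoulidis–Schulze, Duke 2025, Cor. 1.5 (b), `n = 4`): a simply connected closed embedded hypersurface of
   `ℝ⁵` with Colding–Minicozzi entropy `≤ λ(S²(2) × ℝ²) = 4/e` is diffeomorphic to `S⁴`;
2. `Literature.Geometry.Riemannian.CheegerYauZonalSphereFour` — named published fact (Cheeger–Yau 1981 on the typed zonal
   heat series of `S⁴`; its half `σ ≥ 1` is proved in `SphericalCylinderCheegerYauLargeScale.lean`);
3. SLAB CONFINEMENT (hypothesis `hslab`, the registered stub `stub_slabConfinement` of the line, stated verbatim): for
   every `η > 0` there is `ε > 0` such that every compact connected smooth end-separating cross-section with cylinder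
   entropy `≤ 1 + ε` lies in a slab `|z₅ − t₀| ≤ η` — a NEW theorem (Hausdorff stability of the slices), promoted to an
   item of the route; it is NOT asserted here.

Mechanism (idea card `conformal-kernel-domination`): the conformal diffeomorphism `Φ(z) = e^{z₅} z'`, `N → ℝ⁵ ∖ {0}`,
sends slices to round spheres (`λ(S⁴) = 32/(3e²) = 1.4436 < 4/e = 1.4715`); `Φ ∘ ι` is a smooth embedding
(`stub_conformalEmbedding`, PROVED); for a cross-section in a thin slab the Euclidean Gaussian areas of `Φ(range ι)`
are `≤ (1 + 1/100)·λ_cyl` at small scales (`SphericalCylinderConformal.smallScaleDomination_of_cheegerYau`, PROVED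
modulo 2.) and `≤ λ(S⁴) + 1/100` at unit and large scales (`stub_groundStateContinuity`, PROVED), both `≤ 4/e`
(`(1.01)² ≤ 4/e`, `32/(3e²) + 1/100 ≤ 4/e`); the instances `CompactSpace / PathConnectedSpace / SimplyConnectedSpace M`
come from `M ≃ₕ S⁴` (tree); then 1. concludes. With `t₁ := t₁(1/100)`, `(η, ε_unit) := (η, ε)(1/100, t₁)`,
`ε_slab := ε(min η 1)` the crux holds with `ε := min (min ε_unit ε_slab) (1/100)`.

This file asserts no route item unconditionally (the theorem is CONDITIONAL on 1.–3.; the gate records it as such) and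
introduces no definition.
-/

noncomputable section

-- the registered namespace `Summit.SmoothPoincare4.SmoothPoincare4.Theorems…` repeats a component
set_option linter.dupNamespace false

open MeasureTheory Set
open scoped Manifold ContDiff ENNReal Topology BigOperators ContinuousMap

namespace Summit.SmoothPoincare4.SmoothPoincare4.Theorems.CylinderEntropySliceIsolation

open Literature.Geometry.Riemannian
open Literature.Geometry.Riemannian.SphericalCylinderEntropy (cylEntropy measure_ratio_le_cylEntropy
  hausdorffMeasure_sphere_four_pos hausdorffMeasure_sphere_four_lt_top)

/-- The conformal map `Φ(z) = e^{z₅} z'` as the literal lambda of the registered stubs (syntactic notation). -/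
local notation "Φ" => (fun z : EuclideanSpace ℝ (Fin 6) =>
  (WithLp.toLp 2 (fun i : Fin 5 => Real.exp (z 5) * z (Fin.castSucc i)) : EuclideanSpace ℝ (Fin 5)))

/-- `32/(3e²) + 1/100 ≤ 4/e`: the unit-scale budget `λ(S⁴) + δ` stays below `λ(S² × ℝ²)`. [folklore] -/
theorem sphereEntropy_add_le : 32 / (3 * Real.exp 1 ^ 2) + 1 / 100 ≤ 4 / Real.exp 1 := by
  have he1 : (2.7182818283 : ℝ) < Real.exp 1 := Real.exp_one_gt_d9
  have he2 : Real.exp 1 < 2.7182818286 := Real.exp_one_lt_d9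
  have he0 : 0 < Real.exp 1 := Real.exp_pos 1
  rw [div_add_div _ _ (by positivity) (by norm_num : (100 : ℝ) ≠ 0),
    div_le_div_iff₀ (by positivity) he0]
  nlinarith [mul_pos he0 he0, sq_nonneg (Real.exp 1)]

/-- `(1 + 1/100)² ≤ 4/e`: the small-scale budget. [folklore] -/
theorem smallScale_budget_le : (1 + 1 / 100 : ℝ) * (1 + 1 / 100) ≤ 4 / Real.exp 1 := by
  have he2 : Real.exp 1 < 2.7182818286 := Real.exp_one_lt_d9
  have he0 : 0 < Real.exp 1 := Real.exp_pos 1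
  rw [le_div_iff₀ he0]
  nlinarith

/-- **`SliceIsolation` from the CMS fact, the Cheeger–Yau fact and slab confinement** (line
`conformal-kernel-domination`, reduction of crux stmt-SmoothPoincare4-7632; conditional on its three hypotheses, of which the
third — slab confinement — is the promoted stub `stub_slabConfinement`, stated verbatim). [folklore] -/
theorem sliceIsolation_of_slabConfinement
    (hCMS : ChodoshMantoulidisSchulze2025_lowEntropy_sphere_four)
    (hCY : CheegerYauZonalSphereFour)
    (hslab : ∀ η : ℝ, 0 < η → ∃ ε : ℝ, 0 < ε ∧
      ∀ (M : Type) [TopologicalSpace M] [T2Space M] [SecondCountableTopology M]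
        [ChartedSpace (EuclideanSpace ℝ (Fin 4)) M] [IsManifold (𝓡 4) ∞ M] [CompactSpace M]
        [ConnectedSpace M] (ι : M → EuclideanSpace ℝ (Fin 6)), Manifold.IsSmoothEmbedding (𝓡 4) (𝓡 6) ∞ ι →
        (∀ x, ∑ i : Fin 5, ι x (Fin.castSucc i) ^ 2 = 1) →
        (∃ R : ℝ, ∀ a b : EuclideanSpace ℝ (Fin 6), ∑ i : Fin 5, a (Fin.castSucc i) ^ 2 = 1 →
          ∑ i : Fin 5, b (Fin.castSucc i) ^ 2 = 1 → a 5 ≤ -R → R ≤ b 5 →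
          ¬ JoinedIn ({z : EuclideanSpace ℝ (Fin 6) | ∑ i : Fin 5, z (Fin.castSucc i) ^ 2 = 1} \ Set.range ι) a b) →
        cylEntropy (Set.range ι) ≤ ENNReal.ofReal (1 + ε) →
        ∃ t₀ : ℝ, ∀ z ∈ Set.range ι, |z 5 - t₀| ≤ η) :
    Summit.SmoothPoincare4.SmoothPoincare4.Theses.CylinderEntropy.SliceIsolation := by
  -- the constants of the line
  obtain ⟨t₁, ht₁, Hsmall⟩ := SphericalCylinderConformal.smallScaleDomination_of_cheegerYau hCY (1 / 100) (by norm_num)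
  obtain ⟨η, hη, εu, hεu, Hunit⟩ := stub_groundStateContinuity (1 / 100) (by norm_num) t₁ ht₁
  obtain ⟨εs, hεs, Hslab⟩ := hslab (min η 1) (lt_min hη one_pos)
  refine ⟨min (min εu εs) (1 / 100), lt_min (lt_min hεu hεs) (by norm_num), ?_⟩
  intro M _ _ _ _ _ e ι hι hN hsep hent
  -- instances from `M ≃ₕ S⁴` (PROVED in the tree)
  haveI : CompactSpace M :=
    Literature.Topology.FourManifolds.compactSpace_of_homotopyEquiv_sphere_four_holds M e
  haveI : PathConnectedSpace M := by
    haveI := Literature.Topology.FourManifolds.pathConnectedSpace_sphere_four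
    exact Literature.Topology.FourManifolds.pathConnectedSpace_of_homotopyEquiv e
  have hsc : SimplyConnectedSpace M :=
    Literature.Topology.FourManifolds.simplyConnectedSpace_of_homotopyEquiv_sphere_four
      Literature.Topology.FourManifolds.simplyConnectedSpace_sphere_four_holds M e
  -- the cross-section `A = range ι ⊆ N`
  have hAN : Set.range ι ⊆ {z : EuclideanSpace ℝ (Fin 6) | ∑ i : Fin 5, z (Fin.castSucc i) ^ 2 = 1} := by
    rintro _ ⟨x, rfl⟩
    exact hN x
  have hAm : MeasurableSet (Set.range ι) :=
    (isCompact_range hι.isEmbedding.continuous).isClosed.measurableSet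
  have hε_u : min (min εu εs) (1 / 100) ≤ εu := (min_le_left _ _).trans (min_le_left _ _)
  have hε_s : min (min εu εs) (1 / 100) ≤ εs := (min_le_left _ _).trans (min_le_right _ _)
  have hε_c : min (min εu εs) (1 / 100) ≤ 1 / 100 := min_le_right _ _
  have hent' : cylEntropy (Set.range ι) < ENNReal.ofReal (1 + min (min εu εs) (1 / 100)) := hent
  have hent_u : cylEntropy (Set.range ι) ≤ ENNReal.ofReal (1 + εu) :=
    hent'.le.trans (ENNReal.ofReal_le_ofReal (by linarith))
  have hent_s : cylEntropy (Set.range ι) ≤ ENNReal.ofReal (1 + εs) :=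
    hent'.le.trans (ENNReal.ofReal_le_ofReal (by linarith))
  have hent_c : cylEntropy (Set.range ι) ≤ ENNReal.ofReal (1 + 1 / 100) :=
    hent'.le.trans (ENNReal.ofReal_le_ofReal (by linarith))
  -- SLAB CONFINEMENT: the cross-section lies in a thin slab around some height `t₀`
  obtain ⟨t₀, hslab'⟩ := Hslab M ι hι hN hsep hent_s
  have hslabη : ∀ z ∈ Set.range ι, |z 5 - t₀| ≤ η := fun z hz => (hslab' z hz).trans (min_le_left _ _)
  have hslab1 : ∀ z ∈ Set.range ι, |z 5 - t₀| ≤ 1 := fun z hz => (hslab' z hz).trans (min_le_right _ _)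
  -- area budget from the tree (`measure_ratio_le_cylEntropy`, bounded height from the slab)
  have hS0 : μH[4] (Metric.sphere (0 : EuclideanSpace ℝ (Fin 5)) 1) ≠ 0 := hausdorffMeasure_sphere_four_pos.ne'
  have hStop : μH[4] (Metric.sphere (0 : EuclideanSpace ℝ (Fin 5)) 1) ≠ ⊤ := hausdorffMeasure_sphere_four_lt_top.ne
  have hB : ∀ z ∈ Set.range ι, |z 5| ≤ |t₀| + 1 := by
    intro z hz
    have h1 := hslab1 z hz
    calc |z 5| = |(z 5 - t₀) + t₀| := by ring_nf
      _ ≤ |z 5 - t₀| + |t₀| := abs_add_le _ _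
      _ ≤ |t₀| + 1 := by linarith
  have hratio : (μH[4] (Metric.sphere (0 : EuclideanSpace ℝ (Fin 5)) 1))⁻¹ * μH[4] (Set.range ι) ≤
      ENNReal.ofReal (1 + εu) :=
    (measure_ratio_le_cylEntropy hAm (fun z hz => hAN hz) hB).trans hent_u
  have harea : μH[4] (Set.range ι) ≤
      ENNReal.ofReal (1 + εu) * μH[4] (Metric.sphere (0 : EuclideanSpace ℝ (Fin 5)) 1) := by
    calc μH[4] (Set.range ι) = μH[4] (Metric.sphere (0 : EuclideanSpace ℝ (Fin 5)) 1) *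
          ((μH[4] (Metric.sphere (0 : EuclideanSpace ℝ (Fin 5)) 1))⁻¹ * μH[4] (Set.range ι)) := by
          rw [← mul_assoc, ENNReal.mul_inv_cancel hS0 hStop, one_mul]
      _ ≤ μH[4] (Metric.sphere (0 : EuclideanSpace ℝ (Fin 5)) 1) * ENNReal.ofReal (1 + εu) := by gcongr
      _ = ENNReal.ofReal (1 + εu) * μH[4] (Metric.sphere (0 : EuclideanSpace ℝ (Fin 5)) 1) := mul_comm _ _
  -- the Euclidean entropy of `Φ(range ι)` is at most `4/e = λ(S² × ℝ²)`
  have hbound : gaussianEntropy 4 (Φ '' Set.range ι) ≤ gaussianEntropy 4 (shrinkingCylinder 4 2) := by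
    rw [gaussianEntropy_shrinkingCylinder_four_two, gaussianEntropy_eq_iSup]
    refine iSup_le fun y => iSup_le fun t => iSup_le fun ht => ?_
    rcases le_or_gt t (t₁ * Real.exp (2 * t₀)) with hle | hgt
    · -- small scales: conformal domination modulo Cheeger–Yau
      calc gaussianArea 4 y t (Φ '' Set.range ι)
          ≤ ENNReal.ofReal (1 + 1 / 100) * cylEntropy (Set.range ι) := Hsmall t₀ _ hAN hAm hslab1 y t ht hle
        _ ≤ ENNReal.ofReal (1 + 1 / 100) * ENNReal.ofReal (1 + 1 / 100) := by gcongr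
        _ = ENNReal.ofReal ((1 + 1 / 100) * (1 + 1 / 100)) := (ENNReal.ofReal_mul (by norm_num)).symm
        _ ≤ ENNReal.ofReal (4 / Real.exp 1) := ENNReal.ofReal_le_ofReal smallScale_budget_le
    · -- unit and large scales: ground-state continuity
      calc gaussianArea 4 y t (Φ '' Set.range ι)
          ≤ gaussianEntropy 4 (Metric.sphere (0 : EuclideanSpace ℝ (Fin 5)) 1) + ENNReal.ofReal (1 / 100) :=
            Hunit t₀ _ hAN hAm hsep hslabη harea y t hgt.le
        _ = ENNReal.ofReal (32 / (3 * Real.exp 1 ^ 2) + 1 / 100) := by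
            rw [gaussianEntropy_sphere_four (0 : EuclideanSpace ℝ (Fin 5)) one_pos,
              ← ENNReal.ofReal_add (by positivity) (by norm_num)]
        _ ≤ ENNReal.ofReal (4 / Real.exp 1) := ENNReal.ofReal_le_ofReal sphereEntropy_add_le
  -- recognition: `Φ ∘ ι` is a smooth embedding (PROVED stub) and the CMS fact, clause (b)
  have hemb : Manifold.IsSmoothEmbedding (𝓡 4) (𝓡 5) ∞ (Φ ∘ ι) := stub_conformalEmbedding M ι hι hN
  refine hCMS.of_le_shrinkingCylinder_two M hsc hemb ?_
  rwa [Set.range_comp]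

/-- Registered helper `helper_sliceIsolationReduction` of crux stmt-SmoothPoincare4-7632 (the reduction above, as the registered
one-line `Prop`: CMS fact → Cheeger–Yau fact → slab confinement → `SliceIsolation`). [folklore] -/
theorem helper_sliceIsolationReduction :
    Literature.Geometry.Riemannian.ChodoshMantoulidisSchulze2025_lowEntropy_sphere_four →
    Literature.Geometry.Riemannian.CheegerYauZonalSphereFour →
    (∀ η : ℝ, 0 < η → ∃ ε : ℝ, 0 < ε ∧
      ∀ (M : Type) [TopologicalSpace M] [T2Space M] [SecondCountableTopology M]
        [ChartedSpace (EuclideanSpace ℝ (Fin 4)) M] [IsManifold (𝓡 4) ∞ M] [CompactSpace M]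
        [ConnectedSpace M] (ι : M → EuclideanSpace ℝ (Fin 6)), Manifold.IsSmoothEmbedding (𝓡 4) (𝓡 6) ∞ ι →
        (∀ x, ∑ i : Fin 5, ι x (Fin.castSucc i) ^ 2 = 1) →
        (∃ R : ℝ, ∀ a b : EuclideanSpace ℝ (Fin 6), ∑ i : Fin 5, a (Fin.castSucc i) ^ 2 = 1 →
          ∑ i : Fin 5, b (Fin.castSucc i) ^ 2 = 1 → a 5 ≤ -R → R ≤ b 5 →
          ¬ JoinedIn ({z : EuclideanSpace ℝ (Fin 6) | ∑ i : Fin 5, z (Fin.castSucc i) ^ 2 = 1} \ Set.range ι) a b) →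
        Literature.Geometry.Riemannian.SphericalCylinderEntropy.cylEntropy (Set.range ι) ≤ ENNReal.ofReal (1 + ε) →
        ∃ t₀ : ℝ, ∀ z ∈ Set.range ι, |z 5 - t₀| ≤ η) →
    Summit.SmoothPoincare4.SmoothPoincare4.Theses.CylinderEntropy.SliceIsolation :=
  sliceIsolation_of_slabConfinement

end Summit.SmoothPoincare4.SmoothPoincare4.Theorems.CylinderEntropySliceIsolation

end
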